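import Literature.NumberTheory.GaloisRepresentations.LocalLayerTwistedRestriction
import Literature.NumberTheory.GaloisRepresentations.SemiLocalShapiro
import HarnessLib

/-!
# The local layer `Hⁿ(V_v ⧸ N_{v,s}, (K̄_vˣ)^{N_{v,s}})` of the `S`-idèle localisation IS the Galois cohomology
# `Hⁿ(G_{w_s}(E/L), E_{w_s}ˣ)` of the completed layer at the place `w_s` cut out by `K̄ →(s⁻¹)→ K̄ → K̄_v`
# (Cassels–Fröhlich II §10, VII §1.1; Harari §13.1, §17.5 Lemma 17.23, Prop. 17.25)

Topic `NumberTheory/GaloisRepresentations`; namespace `Literature.NumberTheory.GaloisRepresentations.IdeleReadout`.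
Definitions with bodies and theorems; NO named fact, no `sorry`, no instance, no notation; number fields in `Type`.
Sequel of `LocalLayerTwistedRestriction.lean` (the GROUP half: `twistEmb`, `locRestrict`, `locPlace`, `locPlaceOver`,
`locDecompEquiv : V_v ⧸ N_{v,s} ≃* G_{w_s}(E/L)`; notation as there) — this file is the MODULE and COHOMOLOGY half of
sub-lemma (i) of brick [P2-mono] / P2-b (lane «PT-Ш-S-TC», cell `bsd-eis`, crux `GoodLatticeBDPValue` =
stmt-BirchSwinnertonDyer-19032; asked for by bsd-line-x1-p1-w8 g13, consumed by its (ii)).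

THE LAYER MODULE is door-c4's `(invariantsQuotFunctor ℤ N_{v,s}).obj ((resD ℤ V_v).obj (unitsD K_v))` — the
`N_{v,s}`-invariants of `K̄_vˣ` as a representation of `V_v ⧸ N_{v,s}` (`locUnitsLayerRep`, token for token the module
of LEAD bsd-line-x1-p1 g11's `locLayerClass` at `w = inr v`).  (§3) The `N_{v,s}`-invariants of `K̄_vˣ` are the units of
the compositum `K_v(ι_s E) = placeEmb(E_{w_s})` (`exists_placeEmb_eq_of_forall_smul`, `smul_placeEmb_of_restrict_eq_one`:
`N_{v,s}` is exactly the set of `d ∈ Γ_{K_v}` restricting trivially to `E` along `ι_s`, given `V̄_E ≤ U`), i.e.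
`≃ E_{w_s}ˣ` (`locUnitsEquiv`, inverse of `ofLocalUnits = placeEmb` on units), equivariantly along `locDecompEquiv`
(`placeEmb_galAdicCompletionMap`); (§4) hence Mathlib's `groupCohomology.mapIso`:

  `Hⁿ(V_v ⧸ N_{v,s}, (K̄_vˣ)^{N_{v,s}}) ≅ Hⁿ(G_{w_s}(E/L), E_{w_s}ˣ)`   (`locLayerCohomologyIso`, every `n`)

in door-c5's `SemiLocal.localUnitsRep` currency (the codomain of the Shapiro isomorphism
`SemiLocal.groupCohomologyUnitsRepIso (locPlaceOver …) n` over the base `L`), and, composed with door-c5's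
`groupCohomologyLocalUnitsRepIso`, `≅ Hⁿ(Gal(E_{w_s}/L_u), E_{w_s}ˣ)` (`locLayerCohomologyIsoAut`).  The `hom` of the
isomorphism is `groupCohomology.map` along the explicit pair (`locDecompEquiv⁻¹`, `locUnitsEquiv`) (Mathlib `mapIso_hom`)
whose formulas on elements are `coe_locDecompHom_apply` (`d ↦ g_s (d|_E) g_s⁻¹`) and `placeEmbUnits_locUnitsEquiv`
(`placeEmb ∘ locUnitsEquiv = id` in `K̄_v`; with `placeEmb_twistEmb_eq` of the prequel this reads the `w_s`-component
through door-c6's canonical embedding), so that the consumer's matching with the idèle place components is a `map_comp`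
computation.

HONEST FRAMING: local Galois bookkeeping; no arithmetic duality statement and nothing about BSD is proved here.
AI formalisation, established only by the kernel check.

## References
* J. W. S. Cassels, A. Fröhlich (eds.), *Algebraic Number Theory* (1967), Ch. II (Cassels) §10, Ch. VII (Tate) §1.1,
  Prop. 1.2. [CasselsFrohlichANT1967]
* D. Harari, *Galois Cohomology and Class Field Theory*, Universitext (2020), §4.3 Remark 4.24, §13.1 (before Prop. 13.1),
  Prop. 13.1 (b), §17.5 Lemma 17.23, Prop. 17.25. [Harari2020]
* J. Neukirch, *Algebraic Number Theory* (1999), Ch. II (8.1)–(8.3). [NeukirchANT1999]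
* J.-P. Serre, *Local Fields*, GTM 67 (1979), VII §5 (functoriality `(f, φ)^*` of group cohomology). [Serre1979]
-/

noncomputable section

open NumberField IsDedekindDomain Field CategoryTheory
open Literature.Algebra.Homology Literature.Algebra.Homology.DiscreteRep
open Literature.NumberTheory.Automorphic

namespace Literature.NumberTheory.GaloisRepresentations

namespace IdeleReadout

open IdeleClassBar SemiLocal DiscreteGaloisModule
open Literature.NumberTheory.GaloisRepresentations.LocalWeilDatum (galFixing)

variable (K : Type) [Field K] [NumberField K] (S : Finset (HeightOneSpectrum (𝓞 K)))
  (U : Subgroup (GaloisGroupUnramifiedOutside K (↑S : Set (HeightOneSpectrum (𝓞 K))))) [hUn : U.Normal]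
  {E : GalLayer K} [IsGalois K E.1] [NumberField E.1]
  (hE : ramificationSubgroup K (↑S : Set (HeightOneSpectrum (𝓞 K))) ≤ galFixing K E.1)
  (hEU : (layerSubgroupS S E : Subgroup (GaloisGroupUnramifiedOutside K (↑S : Set (HeightOneSpectrum (𝓞 K))))) ≤ U)
  (v : HeightOneSpectrum (𝓞 K)) (s : GaloisGroupUnramifiedOutside K (↑S : Set (HeightOneSpectrum (𝓞 K))))

/-! ## §3 The units: `(K̄_vˣ)^{N_{v,s}} ≃ E_{w_s}ˣ` -/

section UnitsLayer

variable (E) in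
omit [IsGalois K E.1] [NumberField E.1] in
/-- **The layer module `(K̄_vˣ)^{N_{v,s}}` as a representation of `V_v ⧸ N_{v,s}`** (door-c4's
`(invariantsQuotFunctor ℤ N_{v,s}).obj ((resD ℤ V_v).obj (unitsD K_v))`, an abbreviation — token for token the module of
LEAD g11's `locLayerClass` at `w = inr v`). [cite: Harari2020, §4.3 Remark 4.24, §17.5 Lemma 17.23] -/
abbrev locUnitsLayerRep :
    Rep ℤ (↥(U.comap (decompMapPlaceS K S (Sum.inr v : Place K))) ⧸
      (comapOpenNormalSubgroup (conjHom (decompMapPlaceS K S (Sum.inr v : Place K)) U s)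
        (continuous_conjHom (decompMapPlaceS K S (Sum.inr v : Place K)) (continuous_decompMapPlaceS K S _) U s)
        (traceOpenNormalSubgroup U (layerSubgroupS S E)) : Subgroup ↥(U.comap (decompMapPlaceS K S (Sum.inr v : Place K))))) :=
  (invariantsQuotFunctor ℤ
    (comapOpenNormalSubgroup (conjHom (decompMapPlaceS K S (Sum.inr v : Place K)) U s)
      (continuous_conjHom (decompMapPlaceS K S (Sum.inr v : Place K)) (continuous_decompMapPlaceS K S _) U s)
      (traceOpenNormalSubgroup U (layerSubgroupS S E)) : Subgroup ↥(U.comap (decompMapPlaceS K S (Sum.inr v : Place K))))).obj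
    ((resD ℤ (U.comap (decompMapPlaceS K S (Sum.inr v : Place K)))).obj (unitsD (Place.Completion (Sum.inr v : Place K))))

/-- **`y ↦ placeEmb y : E_{w_s}ˣ →* K̄_vˣ`** on units. [cite: NeukirchANT1999, Ch. II (8.1)] -/
def placeEmbUnitsHom :
    ((locPlace K S hE v s : HeightOneSpectrum (𝓞 E.1)).adicCompletion E.1)ˣ →* (AlgebraicClosure (Place.Completion (Sum.inr v : Place K)))ˣ :=
  Units.map (placeEmb v (twistEmb K S hE s)).toRingHom.toMonoidHom

/-- The unit `placeEmb y ∈ K̄_vˣ` of a unit `y` of `E_{w_s}`. [cite: NeukirchANT1999, Ch. II (8.1)] -/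
abbrev placeEmbUnits (y : ((locPlace K S hE v s : HeightOneSpectrum (𝓞 E.1)).adicCompletion E.1)ˣ) :
    (AlgebraicClosure (Place.Completion (Sum.inr v : Place K)))ˣ :=
  placeEmbUnitsHom K S hE v s y

/-- Formula. [cite: NeukirchANT1999, Ch. II (8.1)] -/
@[simp] theorem coe_placeEmbUnits (y : ((locPlace K S hE v s : HeightOneSpectrum (𝓞 E.1)).adicCompletion E.1)ˣ) :
    (placeEmbUnits K S hE v s y : AlgebraicClosure (Place.Completion (Sum.inr v : Place K))) =
      placeEmb v (twistEmb K S hE s) (y : (locPlace K S hE v s : HeightOneSpectrum (𝓞 E.1)).adicCompletion E.1) := rfl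

/-- `placeEmb_twistEmb_eq` of the prequel on units: the canonical reading of `placeEmbUnitsHom`. [cite: CasselsFrohlichANT1967, Ch. VII §1.1] -/
theorem coe_placeEmbUnitsHom_eq (y : ((locPlace K S hE v s : HeightOneSpectrum (𝓞 E.1)).adicCompletion E.1)ˣ) :
    (placeEmbUnitsHom K S hE v s y : AlgebraicClosure (Place.Completion (Sum.inr v : Place K))) =
      placeEmb v E.1.val (galAdicCompletionMap (restrictHomS S hE s)⁻¹ (inv_smul_coe_locPlace K S hE v s)
        (y : (locPlace K S hE v s : HeightOneSpectrum (𝓞 E.1)).adicCompletion E.1)) :=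
  placeEmb_twistEmb_eq K S hE v s _

/-- The image of `placeEmb` on units is fixed by every `d ∈ N_{v,s}` (such `d` restrict trivially to `E`:
`smul_placeEmb_of_restrict_eq_one`). [cite: CasselsFrohlichANT1967, Ch. VII §1.1] -/
theorem smul_placeEmbUnits_of_locRestrict_eq_one (d : absoluteGaloisGroup (Place.Completion (Sum.inr v : Place K)))
    (hd : locRestrict K S hE v s d = 1)
    (y : ((locPlace K S hE v s : HeightOneSpectrum (𝓞 E.1)).adicCompletion E.1)ˣ) :
    d • placeEmbUnits K S hE v s y = placeEmbUnits K S hE v s y := by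
  refine Units.ext ?_
  rw [Units.coe_smul, coe_placeEmbUnits]
  refine smul_placeEmb_of_restrict_eq_one v (twistEmb K S hE s) (fun e => ?_) _
  have h2 := twistEmb_locRestrict K S hE v s d e
  rw [hd, AlgEquiv.one_apply] at h2
  exact h2

/-- **`y ↦ placeEmb y : E_{w_s}ˣ → (K̄_vˣ)^{N_{v,s}}`** (the `K_v`-embedding of the completed layer at the distinguished
place, on units, landing in the `N_{v,s}`-invariants). [cite: NeukirchANT1999, Ch. II (8.1)–(8.3)][cite: CasselsFrohlichANT1967, Ch. VII §1.1] -/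
def ofLocalUnits :
    Additive ((locPlace K S hE v s : HeightOneSpectrum (𝓞 E.1)).adicCompletion E.1)ˣ →+
      (locUnitsLayerRep K S U E v s).V :=
  AddMonoidHom.mk'
    (fun y => ⟨(Additive.ofMul (placeEmbUnits K S hE v s (Additive.toMul y)) : UnitsCarrier (Place.Completion (Sum.inr v : Place K))),
      fun n => congrArg Additive.ofMul (smul_placeEmbUnits_of_locRestrict_eq_one K S hE v s
        (n.1 : absoluteGaloisGroup (Place.Completion (Sum.inr v : Place K))) ((locRestrict_eq_one_iff_mem K S U hE v s n.1).2 n.2) (Additive.toMul y))⟩)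
    fun y y' => Subtype.ext (by
      exact congrArg Additive.ofMul (map_mul (placeEmbUnitsHom K S hE v s) (Additive.toMul y) (Additive.toMul y')))

/-- Formula: the underlying unit of `K̄_v` of `ofLocalUnits y` is `placeEmb y`. [cite: NeukirchANT1999, Ch. II (8.1)] -/
@[simp] theorem toMul_coe_ofLocalUnits
    (y : Additive ((locPlace K S hE v s : HeightOneSpectrum (𝓞 E.1)).adicCompletion E.1)ˣ) :
    (Additive.toMul ((ofLocalUnits K S U hE v s y).1 : UnitsCarrier (Place.Completion (Sum.inr v : Place K))) :
        (AlgebraicClosure (Place.Completion (Sum.inr v : Place K)))ˣ) = placeEmbUnits K S hE v s (Additive.toMul y) := rfl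

/-- `ofLocalUnits` is injective (`placeEmb` is). [cite: NeukirchANT1999, Ch. II (8.1)] -/
theorem ofLocalUnits_injective : Function.Injective (ofLocalUnits K S U hE v s) := by
  intro y y' h
  have h1 : placeEmbUnits K S hE v s (Additive.toMul y) = placeEmbUnits K S hE v s (Additive.toMul y') :=
    congrArg (fun z : (locUnitsLayerRep K S U E v s).V =>
      (Additive.toMul (z.1 : UnitsCarrier (Place.Completion (Sum.inr v : Place K))) : (AlgebraicClosure (Place.Completion (Sum.inr v : Place K)))ˣ)) h
  have h2 := congrArg (fun x : (AlgebraicClosure (Place.Completion (Sum.inr v : Place K)))ˣ => (x : AlgebraicClosure (Place.Completion (Sum.inr v : Place K)))) h1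
  simp only [coe_placeEmbUnits] at h2
  exact congrArg Additive.ofMul (Units.ext (placeEmb_injective v (twistEmb K S hE s) h2))

/-- A unit of `K̄_v` fixed by every `d ∈ Γ_{K_v}` restricting trivially to `E` along `ι_s` is `placeEmb y` for a unit `y`
of `E_{w_s}` (`exists_placeEmb_eq_of_forall_smul`: `K̄_v/K_v` is Galois, the fixed field of `Gal(K̄_v/K_v(ι_s E))` is
`K_v(ι_s E) = placeEmb(E_{w_s})`). [cite: CasselsFrohlichANT1967, Ch. VII §1.1][cite: NeukirchANT1999, Ch. II (8.1)–(8.3)] -/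
theorem exists_placeEmbUnitsHom_eq (x : (AlgebraicClosure (v.adicCompletion K))ˣ)
    (hx : ∀ d : absoluteGaloisGroup (v.adicCompletion K),
      (∀ e : E.1, absGaloisRestrict K (v.adicCompletion K) d • twistEmb K S hE s e = twistEmb K S hE s e) →
        d • (x : AlgebraicClosure (v.adicCompletion K)) = x) :
    ∃ y, placeEmbUnitsHom K S hE v s y = x := by
  obtain ⟨y, hy⟩ := exists_placeEmb_eq_of_forall_smul v (twistEmb K S hE s) hx
  have hy0 : y ≠ 0 := by
    rintro rfl
    rw [map_zero] at hy
    exact x.ne_zero hy.symm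
  exact ⟨Units.mk0 y hy0, Units.ext hy⟩

include hEU in
/-- **`ofLocalUnits` is onto**: a unit of `K̄_v` fixed by `N_{v,s}` is fixed by every `d ∈ Γ_{K_v}` restricting trivially to `E`
along `ι_s` (such `d` lie in `V_v`, as `V̄_E ≤ U`, hence in `N_{v,s}`), so it comes from `E_{w_s}ˣ`.
[cite: CasselsFrohlichANT1967, Ch. VII §1.1][cite: NeukirchANT1999, Ch. II (8.1)–(8.3)] -/
theorem ofLocalUnits_surjective : Function.Surjective (ofLocalUnits K S U hE v s) := by
  intro z
  obtain ⟨y, hy⟩ := exists_placeEmbUnitsHom_eq K S hE v s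
    (Additive.toMul (z.1 : UnitsCarrier (Place.Completion (Sum.inr v : Place K))) : (AlgebraicClosure (Place.Completion (Sum.inr v : Place K)))ˣ) (fun d hd => by
      obtain ⟨hdV, hdN⟩ := mem_locLayerSubgroup_of_forall_smul K S U hE hEU v s d hd
      exact congrArg (fun w : UnitsCarrier (Place.Completion (Sum.inr v : Place K)) =>
        ((Additive.toMul w : (AlgebraicClosure (Place.Completion (Sum.inr v : Place K)))ˣ) : AlgebraicClosure (Place.Completion (Sum.inr v : Place K)))) (z.2 ⟨⟨d, hdV⟩, hdN⟩))
  refine ⟨Additive.ofMul y, Subtype.ext ?_⟩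
  change Additive.ofMul (placeEmbUnitsHom K S hE v s y) = (z.1 : UnitsCarrier (Place.Completion (Sum.inr v : Place K)))
  rw [hy]
  rfl

variable (u : HeightOneSpectrum (𝓞 (locFixedField K S U hE)))
  (hu : (locPlace K S hE v s : HeightOneSpectrum (𝓞 E.1)).under (𝓞 (locFixedField K S U hE)) = u)

/-- **`(K̄_vˣ)^{N_{v,s}} ≃ₗ[ℤ] E_{w_s}ˣ`** (inverse of `ofLocalUnits`); the codomain is written as the module of door-c5's
`SemiLocal.localUnitsRep (locPlaceOver …)` (the same type), so that Mathlib's `groupCohomology.mapIso` applies verbatim.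
[cite: CasselsFrohlichANT1967, Ch. VII §1.1][cite: Harari2020, §13.1 (before Prop. 13.1)] -/
def locUnitsEquiv :
    letI := (locUnitsLayerRep K S U E v s).hV2
    letI := (localUnitsRep (locPlaceOver K S U hE v s u hu)).hV2
    (locUnitsLayerRep K S U E v s).V ≃ₗ[ℤ] (localUnitsRep (locPlaceOver K S U hE v s u hu)).V :=
  (LinearEquiv.ofBijective (ofLocalUnits K S U hE v s).toIntLinearMap
    ⟨ofLocalUnits_injective K S U hE v s, ofLocalUnits_surjective K S U hE hEU v s⟩).symm

/-- Formula: `locUnitsEquiv⁻¹ y = ofLocalUnits y`. [cite: CasselsFrohlichANT1967, Ch. VII §1.1] -/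
theorem locUnitsEquiv_symm_apply (y : Additive ((locPlace K S hE v s : HeightOneSpectrum (𝓞 E.1)).adicCompletion E.1)ˣ) :
    (locUnitsEquiv K S U hE hEU v s u hu).symm y = ofLocalUnits K S U hE v s y := rfl

/-- Formula: `locUnitsEquiv (ofLocalUnits y) = y`. [cite: CasselsFrohlichANT1967, Ch. VII §1.1] -/
@[simp] theorem locUnitsEquiv_ofLocalUnits (y : Additive ((locPlace K S hE v s : HeightOneSpectrum (𝓞 E.1)).adicCompletion E.1)ˣ) :
    locUnitsEquiv K S U hE hEU v s u hu (ofLocalUnits K S U hE v s y) = y :=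
  (locUnitsEquiv K S U hE hEU v s u hu).apply_symm_apply y

/-- **Formula: `placeEmb (locUnitsEquiv z) = z` in `K̄_v`.** [cite: CasselsFrohlichANT1967, Ch. VII §1.1] -/
theorem placeEmbUnits_locUnitsEquiv (z : (locUnitsLayerRep K S U E v s).V) :
    placeEmbUnits K S hE v s (Additive.toMul (locUnitsEquiv K S U hE hEU v s u hu z)) =
      Additive.toMul (z.1 : UnitsCarrier (Place.Completion (Sum.inr v : Place K))) := by
  have hz : ofLocalUnits K S U hE v s (locUnitsEquiv K S U hE hEU v s u hu z) = z :=
    (locUnitsEquiv K S U hE hEU v s u hu).symm_apply_apply z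
  exact (toMul_coe_ofLocalUnits K S U hE v s _).symm.trans
    (congrArg (fun w : (locUnitsLayerRep K S U E v s).V =>
      (Additive.toMul (w.1 : UnitsCarrier (Place.Completion (Sum.inr v : Place K))) : (AlgebraicClosure (Place.Completion (Sum.inr v : Place K)))ˣ)) hz)

variable (E) in
omit [IsGalois K E.1] [NumberField E.1] in
/-- The action of `[d] ∈ V_v ⧸ N_{v,s}` on the layer module is the Galois action of `d` on `K̄_vˣ` (definitional).
[cite: Harari2020, §4.3 Remark 4.24] -/
theorem toMul_coe_locUnitsLayerRep_ρ_mk (d : ↥(U.comap (decompMapPlaceS K S (Sum.inr v : Place K))))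
    (z : (locUnitsLayerRep K S U E v s).V) :
    (Additive.toMul (((locUnitsLayerRep K S U E v s).ρ (QuotientGroup.mk d) z).1 : UnitsCarrier (Place.Completion (Sum.inr v : Place K))) :
        (AlgebraicClosure (Place.Completion (Sum.inr v : Place K)))ˣ) =
      (d : absoluteGaloisGroup (Place.Completion (Sum.inr v : Place K))) • (Additive.toMul (z.1 : UnitsCarrier (Place.Completion (Sum.inr v : Place K))) : (AlgebraicClosure (Place.Completion (Sum.inr v : Place K)))ˣ) := rfl

/-- Characterisation of `locUnitsEquiv z` as THE unit `y` of `E_{w_s}` with `placeEmb y = z` (the form a matching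
with an independently computed local component uses). [cite: CasselsFrohlichANT1967, Ch. VII §1.1] -/
theorem toMul_locUnitsEquiv_eq_iff (z : (locUnitsLayerRep K S U E v s).V)
    (y : ((locPlace K S hE v s : HeightOneSpectrum (𝓞 E.1)).adicCompletion E.1)ˣ) :
    Additive.toMul (locUnitsEquiv K S U hE hEU v s u hu z) = y ↔
      placeEmbUnitsHom K S hE v s y =
        (Additive.toMul (z.1 : UnitsCarrier (Place.Completion (Sum.inr v : Place K))) :
          (AlgebraicClosure (Place.Completion (Sum.inr v : Place K)))ˣ) := by
  constructor
  · rintro rfl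
    exact placeEmbUnits_locUnitsEquiv K S U hE hEU v s u hu z
  · intro h
    have h' : ofLocalUnits K S U hE v s (Additive.ofMul y) = z :=
      Subtype.ext ((congrArg Additive.ofMul h).trans (ofMul_toMul _))
    -- (no `rw`: explicit `congrArg`/`trans` chain, cf. `locUnitsEquiv_comm`)
    exact congrArg Additive.toMul ((congrArg (locUnitsEquiv K S U hE hEU v s u hu) h'.symm).trans
      (locUnitsEquiv_ofLocalUnits K S U hE hEU v s u hu (Additive.ofMul y)))

/-- The same read in `K̄_v` (units are determined by their values). [cite: CasselsFrohlichANT1967, Ch. VII §1.1] -/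
theorem toMul_locUnitsEquiv_eq_iff' (z : (locUnitsLayerRep K S U E v s).V)
    (y : ((locPlace K S hE v s : HeightOneSpectrum (𝓞 E.1)).adicCompletion E.1)ˣ) :
    Additive.toMul (locUnitsEquiv K S U hE hEU v s u hu z) = y ↔
      placeEmb v (twistEmb K S hE s) (y : (locPlace K S hE v s : HeightOneSpectrum (𝓞 E.1)).adicCompletion E.1) =
        ((Additive.toMul (z.1 : UnitsCarrier (Place.Completion (Sum.inr v : Place K))) :
          (AlgebraicClosure (Place.Completion (Sum.inr v : Place K)))ˣ) : AlgebraicClosure (Place.Completion (Sum.inr v : Place K))) := by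
  rw [toMul_locUnitsEquiv_eq_iff, ← coe_placeEmbUnits]
  exact Units.ext_iff

/-- **Equivariance on `ofLocalUnits`**: `[d] • placeEmb y = placeEmb (ρ_s(d)_{w_s} y)` (`placeEmb_galAdicCompletionMap`).
[cite: CasselsFrohlichANT1967, Ch. VII §1.1] -/
theorem ρ_ofLocalUnits (d : ↥(U.comap (decompMapPlaceS K S (Sum.inr v : Place K))))
    (y : Additive ((locPlace K S hE v s : HeightOneSpectrum (𝓞 E.1)).adicCompletion E.1)ˣ) :
    (locUnitsLayerRep K S U E v s).ρ (QuotientGroup.mk d) (ofLocalUnits K S U hE v s y) =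
      ofLocalUnits K S U hE v s ((localUnitsRep (locPlaceOver K S U hE v s u hu)).ρ (locDecompHom K S U hE v s u hu d) y) := by
  refine Subtype.ext (Additive.toMul.injective (Units.ext ?_))
  have h1 := congrArg (fun x : (AlgebraicClosure (Place.Completion (Sum.inr v : Place K)))ˣ => (x : AlgebraicClosure (Place.Completion (Sum.inr v : Place K))))
    (toMul_coe_locUnitsLayerRep_ρ_mk K S U E v s d (ofLocalUnits K S U hE v s y))
  rw [Units.coe_smul] at h1
  refine h1.trans ?_
  -- both sides now read in `K̄_v`: `d • placeEmb y = placeEmb (ρ_s(d)_{w_s} y)`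
  exact (placeEmb_galAdicCompletionMap v (twistEmb K S hE s) (twistEmb_locRestrict K S hE v s d)
    (congrArg Place.val (locRestrict_smul_locPlace K S hE v s d))
    ((Additive.toMul y : ((locPlace K S hE v s : HeightOneSpectrum (𝓞 E.1)).adicCompletion E.1)ˣ) :
      (locPlace K S hE v s : HeightOneSpectrum (𝓞 E.1)).adicCompletion E.1)).symm

/-- **Equivariance**: `locUnitsEquiv` intertwines the `V_v ⧸ N_{v,s}`-action on `(K̄_vˣ)^{N_{v,s}}` with the
`G_{w_s}(E/L)`-action on `E_{w_s}ˣ` along `locDecompEquiv` (the form Mathlib's `groupCohomology.mapIso` consumes).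
[cite: CasselsFrohlichANT1967, Ch. VII §1.1] -/
theorem locUnitsEquiv_comm
    (q : ↥(U.comap (decompMapPlaceS K S (Sum.inr v : Place K))) ⧸
      (comapOpenNormalSubgroup (conjHom (decompMapPlaceS K S (Sum.inr v : Place K)) U s)
        (continuous_conjHom (decompMapPlaceS K S (Sum.inr v : Place K)) (continuous_decompMapPlaceS K S _) U s)
        (traceOpenNormalSubgroup U (layerSubgroupS S E)) : Subgroup ↥(U.comap (decompMapPlaceS K S (Sum.inr v : Place K))))) :
    letI := (locUnitsLayerRep K S U E v s).hV2
    letI := (localUnitsRep (locPlaceOver K S U hE v s u hu)).hV2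
    (locUnitsEquiv K S U hE hEU v s u hu).toLinearMap ∘ₗ (locUnitsLayerRep K S U E v s).ρ q =
      (localUnitsRep (locPlaceOver K S U hE v s u hu)).ρ (locDecompEquiv K S U hE hEU v s u hu q) ∘ₗ
        (locUnitsEquiv K S U hE hEU v s u hu).toLinearMap := by
  induction q using QuotientGroup.induction_on with
  | H d =>
    refine LinearMap.ext fun z => ?_
    have hz : z = ofLocalUnits K S U hE v s (locUnitsEquiv K S U hE hEU v s u hu z) :=
      ((locUnitsEquiv K S U hE hEU v s u hu).symm_apply_apply z).symm
    have h1 : (locUnitsLayerRep K S U E v s).ρ (QuotientGroup.mk d) z =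
        ofLocalUnits K S U hE v s ((localUnitsRep (locPlaceOver K S U hE v s u hu)).ρ
          (locDecompHom K S U hE v s u hu d) (locUnitsEquiv K S U hE hEU v s u hu z)) :=
      (congrArg (fun w => (locUnitsLayerRep K S U E v s).ρ (QuotientGroup.mk d) w) hz).trans
        (ρ_ofLocalUnits K S U hE v s u hu d _)
    -- (no `rw`: kabstract on these `Rep` terms is pathologically slow — explicit `congrArg`/`trans` chain instead)
    exact (congrArg (locUnitsEquiv K S U hE hEU v s u hu) h1).trans
      (locUnitsEquiv_ofLocalUnits K S U hE hEU v s u hu _)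

end UnitsLayer

/-! ## §4 The isomorphism `Hⁿ(V_v ⧸ N_{v,s}, (K̄_vˣ)^{N_{v,s}}) ≅ Hⁿ(G_{w_s}(E/L), E_{w_s}ˣ)` -/

section Iso

variable (u : HeightOneSpectrum (𝓞 (locFixedField K S U hE)))
  (hu : (locPlace K S hE v s : HeightOneSpectrum (𝓞 E.1)).under (𝓞 (locFixedField K S U hE)) = u)

/-- **`Hⁿ(V_v ⧸ N_{v,s}, (K̄_vˣ)^{N_{v,s}}) ≅ Hⁿ(G_{w_s}(E/L), E_{w_s}ˣ)`** (Mathlib `groupCohomology.mapIso` along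
`locDecompEquiv`, `locUnitsEquiv`), in door-c5's `SemiLocal.localUnitsRep` currency — the codomain of the Shapiro isomorphism
`SemiLocal.groupCohomologyUnitsRepIso (locPlaceOver …) n` for the extension `E/L` at the place `u`.
[cite: Harari2020, §13.1 Prop. 13.1 (b), §17.5 Lemma 17.23][cite: CasselsFrohlichANT1967, Ch. VII §1.1] -/
def locLayerCohomologyIso (n : ℕ) :
    groupCohomology (locUnitsLayerRep K S U E v s) n ≅
      groupCohomology (localUnitsRep (locPlaceOver K S U hE v s u hu)) n :=
  groupCohomology.mapIso (locDecompEquiv K S U hE hEU v s u hu) (locUnitsEquiv K S U hE hEU v s u hu)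
    (locUnitsEquiv_comm K S U hE hEU v s u hu) n

/-- **`Hⁿ(V_v ⧸ N_{v,s}, (K̄_vˣ)^{N_{v,s}}) ≅ Hⁿ(Gal(E_{w_s}/L_u), E_{w_s}ˣ)`** (composite with door-c5's
`groupCohomologyLocalUnitsRepIso`). [cite: Harari2020, §13.1 Prop. 13.1 (b)][cite: CasselsFrohlichANT1967, Ch. VII §1.1] -/
def locLayerCohomologyIsoAut (n : ℕ) :
    groupCohomology (locUnitsLayerRep K S U E v s) n ≅
      groupCohomology (Rep.ofAlgebraAutOnUnits (u.adicCompletion (locFixedField K S U hE))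
        ((locPlaceOver K S U hE v s u hu : HeightOneSpectrum (𝓞 E.1)).adicCompletion E.1)) n :=
  locLayerCohomologyIso K S U hE hEU v s u hu n ≪≫ groupCohomologyLocalUnitsRepIso (locPlaceOver K S U hE v s u hu) n

/-- A class of the local layer vanishes iff its image in `Hⁿ(G_{w_s}(E/L), E_{w_s}ˣ)` does. [cite: Harari2020, §17.5 Prop. 17.25] -/
theorem locLayerCohomologyIso_hom_eq_zero_iff (n : ℕ) (c : groupCohomology (locUnitsLayerRep K S U E v s) n) :
    (locLayerCohomologyIso K S U hE hEU v s u hu n).hom c = 0 ↔ c = 0 := by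
  constructor
  · intro h
    have h' := congrArg (locLayerCohomologyIso K S U hE hEU v s u hu n).inv h
    rwa [Iso.hom_inv_id_apply, map_zero] at h'
  · rintro rfl
    exact map_zero _

/-- The same for the `Aut`-form. [cite: Harari2020, §17.5 Prop. 17.25] -/
theorem locLayerCohomologyIsoAut_hom_eq_zero_iff (n : ℕ) (c : groupCohomology (locUnitsLayerRep K S U E v s) n) :
    (locLayerCohomologyIsoAut K S U hE hEU v s u hu n).hom c = 0 ↔ c = 0 := by
  constructor
  · intro h
    have h' := congrArg (locLayerCohomologyIsoAut K S U hE hEU v s u hu n).inv h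
    rwa [Iso.hom_inv_id_apply, map_zero] at h'
  · rintro rfl
    exact map_zero _

end Iso

end IdeleReadout

end Literature.NumberTheory.GaloisRepresentations

end
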